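import Literature.MathematicalPhysics.QuantumLattice.HubbardGridCounterQuadraticL1
import HarnessLib

/-!
# The grid counterterm `𝒩_{K,N}` as a quadratic insertion `Σ_{X,Y} N_g(X,Y) ψ(X)ψ(Y)`: its matrix `N_g` and the decay-weighted
# row / column sums of `N_g` and of `S_g = N_g − N_gᵀ`

Topic `MathematicalPhysics/QuantumLattice`; sequel of `HubbardGridCounterQuadratic(L1)` (the time-local, space-nonlocal grid counterterm
`𝒩_{K,N} = ε_N Σ_σ Σ_{(j,x⃗),y⃗} Ǩ_L(x⃗ − y⃗) ψ⁺_{((j,x⃗),σ)} ψ⁻_{((j,y⃗),σ)}` of the K3 engine's scale-`0` step, Benfatto–Giuliani–Mastropietro 2003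
§1.2 (2.10), and its pinned `ℓ¹` kernel bounds) in the currency of `GrassmannGaussianQuadraticInsertion` /
`GrassmannGaussianQuadraticInsertionTwoLeg` (a quadratic insertion `q = Σ N(X,Y)ψ(X)ψ(Y)` is resummed into the covariance: the dressed
covariance is `M·C` with `M·(1 + C·S) = 1`, `S = N − Nᵀ`):

* `gridCounterMatrix L N β K` — the MATRIX `N_g` of `𝒩_{K,N}`: `N_g(ψ⁺_{((j,x⃗),σ)}, ψ⁻_{((j,y⃗),σ)}) = ε_N Ǩ_L(x⃗ − y⃗)`, all other entries
  `0` (a sum of elementary matrices over the index set of `hubbardGridCounterQuadratic_eq_sum`);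
* **`sum_sum_gridCounterMatrix_smul`** — `Σ_{X,Y} N_g(X,Y) ψ(X)ψ(Y) = 𝒩_{K,N}`, and the `q`-form `−𝒩_{K,N} = Σ (−N_g)(X,Y) ψ(X)ψ(Y)`
  (`neg_hubbardGridCounterQuadratic_eq_sum_sum`);
* the **decay-weighted pinned sums**: for a pair weight `w ≥ 0` on grid legs dominated on EQUAL-TIME pairs by an even spatial profile,
  `w(X,Y) ≤ ω(x⃗_X − x⃗_Y)` (`ω ≥ 0`, `ω(−z) = ω(z)`), every weighted row and column sum of `N_g` and of any matrix `S` with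
  `‖S(X,Y)‖ ≤ ‖N_g(X,Y)‖ + ‖N_g(Y,X)‖` (so `S_g = N_g − N_gᵀ` and `−S_g`) is at most `ν_ω = (|β|/N)·Σ_z ‖Ǩ_L(z)‖·ω(z)`
  (`rowSum_gridCounterMatrix_le`, `colSum_gridCounterMatrix_le`, `rowSum_le_of_norm_le_gridCounterMatrix`,
  `colSum_le_of_norm_le_gridCounterMatrix`); unweighted: `≤ (|β|/N)·Σ_z ‖Ǩ_L(z)‖`.

With `Literature/Probability/LatticeModels/WeightedRowSumResolvent` these are the `ν`-inputs that transfer the decay constants of a grid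
covariance `G` to the dressed one `(1 + G S_g)⁻¹ G` (the K-resummed representation of the counterterm frame in the cell gate-hubbard-kl).
One definition (`gridCounterMatrix`, a closed form); everything else is proved.

## Sources

G. Benfatto, A. Giuliani, V. Mastropietro, Ann. Henri Poincaré 4 (2003) 137–193, §1.2 (2.9)–(2.10) [`BenfattoGiulianiMastropietro2003`];
G. Benfatto, A. Giuliani, V. Mastropietro, Ann. Henri Poincaré 7 (2006) 809–898, (2.23)–(2.24) and §3 (3.2)–(3.8)
[`BenfattoGiulianiMastropietro2006`].
-/

noncomputable section

namespace Literature.MathematicalPhysics.QuantumLattice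

open GrassmannAlgebra Finset Literature.Probability.LatticeModels

/-! ### An elementary matrix as a quadratic insertion -/

/-- `Σ_{X,Y} (single a b c)(X,Y) • f(X,Y) = c • f(a,b)` (one elementary matrix contributes one term).
[cite: BenfattoGiulianiMastropietro2003, §1.2 The model (2.10)] -/
theorem sum_sum_single_apply_smul {Γ : Type*} [Fintype Γ] [DecidableEq Γ] {V : Type*} [AddCommMonoid V] [Module ℂ V]
    (a b : Γ) (c : ℂ) (f : Γ → Γ → V) :
    ∑ X, ∑ Y, Matrix.single a b c X Y • f X Y = c • f a b := by
  have h : ∀ X Y, Matrix.single a b c X Y • f X Y = if a = X then (if b = Y then c • f X Y else 0) else 0 := by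
    intro X Y
    by_cases hX : a = X
    · by_cases hY : b = Y
      · subst hX; subst hY
        rw [Matrix.single_apply_same, if_pos rfl, if_pos rfl]
      · rw [Matrix.single_apply_of_ne a b c X Y (fun h => hY h.2), zero_smul, if_pos hX, if_neg hY]
    · rw [Matrix.single_apply_of_ne a b c X Y (fun h => hX h.1), zero_smul, if_neg hX]
  simp_rw [h, Finset.sum_ite_irrel, Finset.sum_const_zero, Finset.sum_ite_eq, Finset.mem_univ, if_true]

/-- `Σ_Y ‖(single a b c)(X,Y)‖·g(Y) = [a = X]·‖c‖·g(b)` (one elementary matrix has one nonzero entry per row).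
[cite: BenfattoGiulianiMastropietro2003, §1.2 The model (2.10)] -/
theorem sum_norm_single_apply_mul {Γ : Type*} [Fintype Γ] [DecidableEq Γ] (a b : Γ) (c : ℂ) (X : Γ) (g : Γ → ℝ) :
    ∑ Y, ‖Matrix.single a b c X Y‖ * g Y = if a = X then ‖c‖ * g b else 0 := by
  have h : ∀ Y, ‖Matrix.single a b c X Y‖ * g Y = if a = X then (if b = Y then ‖c‖ * g Y else 0) else 0 := by
    intro Y
    by_cases hX : a = X
    · by_cases hY : b = Y
      · subst hX; subst hY
        rw [Matrix.single_apply_same, if_pos rfl, if_pos rfl]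
      · rw [Matrix.single_apply_of_ne a b c X Y (fun h => hY h.2), norm_zero, zero_mul, if_pos hX, if_neg hY]
    · rw [Matrix.single_apply_of_ne a b c X Y (fun h => hX h.1), norm_zero, zero_mul, if_neg hX]
  simp_rw [h, Finset.sum_ite_irrel, Finset.sum_const_zero, Finset.sum_ite_eq, Finset.mem_univ, if_true]

/-- `Σ_X ‖(single a b c)(X,Y)‖·g(X) = [b = Y]·‖c‖·g(a)` (one elementary matrix has one nonzero entry per column).
[cite: BenfattoGiulianiMastropietro2003, §1.2 The model (2.10)] -/
theorem sum_norm_single_apply_mul' {Γ : Type*} [Fintype Γ] [DecidableEq Γ] (a b : Γ) (c : ℂ) (Y : Γ) (g : Γ → ℝ) :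
    ∑ X, ‖Matrix.single a b c X Y‖ * g X = if b = Y then ‖c‖ * g a else 0 := by
  have h : ∀ X, ‖Matrix.single a b c X Y‖ * g X = if b = Y then (if a = X then ‖c‖ * g X else 0) else 0 := by
    intro X
    by_cases hY : b = Y
    · by_cases hX : a = X
      · subst hX; subst hY
        rw [Matrix.single_apply_same, if_pos rfl, if_pos rfl]
      · rw [Matrix.single_apply_of_ne a b c X Y (fun h => hX h.1), norm_zero, zero_mul, if_pos hY, if_neg hX]
    · rw [Matrix.single_apply_of_ne a b c X Y (fun h => hY h.2), norm_zero, zero_mul, if_neg hY]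
  simp_rw [h, Finset.sum_ite_irrel, Finset.sum_const_zero, Finset.sum_ite_eq, Finset.mem_univ, if_true]

/-! ### The matrix of the grid counterterm -/

variable (L N : ℕ) [NeZero L]

/-- **The matrix of the grid counterterm** `𝒩_{K,N}` as a quadratic insertion: the sum, over the index set
`ι = Fin 2 × (GridPoint L N × (ℤ/Lℤ)²)` of `hubbardGridCounterQuadratic_eq_sum`, of the elementary matrices with entry `ε_N Ǩ_L(x⃗ − y⃗)` at
(row `ψ⁺_{((j,x⃗),σ)}`, column `ψ⁻_{((j,y⃗),σ)}`); so `N_g(ψ⁺_{((j,x⃗),σ)}, ψ⁻_{((j,y⃗),σ)}) = ε_N Ǩ_L(x⃗ − y⃗)` and every other entry vanishes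
(`𝒩_{K,N} = Σ_{X,Y} N_g(X,Y) ψ(X)ψ(Y)`, `sum_sum_gridCounterMatrix_smul`). [cite: BenfattoGiulianiMastropietro2003, §1.2 The model (2.10)] -/
def gridCounterMatrix (β : ℝ) (K : TrigPolyC4v) : Matrix (GridLeg (GridPoint L N)) (GridLeg (GridPoint L N)) ℂ :=
  ∑ i : Fin 2 × (GridPoint L N × TorusSite 2 L),
    Matrix.single (((i.2.1, i.1), 0) : GridLeg (GridPoint L N)) ((((i.2.1.1, i.2.2), i.1), 1) : GridLeg (GridPoint L N))
      ((((β / N : ℝ)) : ℂ) * framePosKernel L K (i.2.1.2 - i.2.2))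

variable {L N}

/-- **`𝒩_{K,N}` is the quadratic insertion of `N_g`**: `Σ_{X,Y} N_g(X,Y) ψ(X)ψ(Y) = 𝒩_{K,N}`. [cite: BenfattoGiulianiMastropietro2003, §1.2 The model (2.10)] -/
theorem sum_sum_gridCounterMatrix_smul (β : ℝ) (K : TrigPolyC4v) :
    ∑ X : GridLeg (GridPoint L N), ∑ Y : GridLeg (GridPoint L N), gridCounterMatrix L N β K X Y • (gen ℂ X * gen ℂ Y) =
      hubbardGridCounterQuadratic L N β K := by
  rw [hubbardGridCounterQuadratic_eq_sum]
  simp_rw [gridCounterMatrix, Matrix.sum_apply, Finset.sum_smul]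
  rw [Finset.sum_congr rfl fun X _ => Finset.sum_comm, Finset.sum_comm]
  exact Finset.sum_congr rfl fun i _ => sum_sum_single_apply_smul _ _ _ _

/-- **The `q`-form**: `−𝒩_{K,N} = Σ_{X,Y} (−N_g)(X,Y) ψ(X)ψ(Y)` — the shape `q = Σ N(X,Y)ψ(X)ψ(Y)` in which `GrassmannGaussianQuadraticInsertion`
resums the counterterm (`e^{−(V + 𝒩)} = e^{−(V − q)}`, `q = −𝒩`). [cite: BenfattoGiulianiMastropietro2006, (2.23)–(2.24)] -/
theorem neg_hubbardGridCounterQuadratic_eq_sum_sum (β : ℝ) (K : TrigPolyC4v) :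
    -hubbardGridCounterQuadratic L N β K =
      ∑ X : GridLeg (GridPoint L N), ∑ Y : GridLeg (GridPoint L N), (-gridCounterMatrix L N β K) X Y • (gen ℂ X * gen ℂ Y) := by
  rw [← sum_sum_gridCounterMatrix_smul, ← Finset.sum_neg_distrib]
  refine Finset.sum_congr rfl fun X _ => ?_
  rw [← Finset.sum_neg_distrib]
  exact Finset.sum_congr rfl fun Y _ => by rw [Matrix.neg_apply, neg_smul]

/-- `V + 𝒩_{K,N} = V − q` with `q = Σ (−N_g)(X,Y)ψ(X)ψ(Y)`: the interaction-plus-counterterm in the shape of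
`GrassmannGaussianQuadraticInsertion.effPartitionFn_sub_of_transpose_eq_neg` / `…TwoLeg`. [cite: BenfattoGiulianiMastropietro2006, (2.23)–(2.24)] -/
theorem add_hubbardGridCounterQuadratic_eq_sub (β : ℝ) (K : TrigPolyC4v) (V : GrassmannAlgebra ℂ (GridLeg (GridPoint L N))) :
    V + hubbardGridCounterQuadratic L N β K =
      V - ∑ X : GridLeg (GridPoint L N), ∑ Y : GridLeg (GridPoint L N), (-gridCounterMatrix L N β K) X Y • (gen ℂ X * gen ℂ Y) := by
  rw [← neg_hubbardGridCounterQuadratic_eq_sum_sum, sub_neg_eq_add]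

/-! ### Entry bounds and charge support -/

/-- The entries of `N_g` are dominated by the elementary-matrix decomposition:
`‖N_g(X,Y)‖ ≤ Σ_i [ψ⁺(i) = X ∧ ψ⁻(i) = Y]·|ε_N|·‖Ǩ_L(x⃗_i − y⃗_i)‖`. [cite: BenfattoGiulianiMastropietro2003, §1.2 The model (2.10)] -/
theorem norm_gridCounterMatrix_le (β : ℝ) (K : TrigPolyC4v) (X Y : GridLeg (GridPoint L N)) :
    ‖gridCounterMatrix L N β K X Y‖ ≤ ∑ i : Fin 2 × (GridPoint L N × TorusSite 2 L),
      ‖Matrix.single (((i.2.1, i.1), 0) : GridLeg (GridPoint L N)) ((((i.2.1.1, i.2.2), i.1), 1) : GridLeg (GridPoint L N))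
        ((((β / N : ℝ)) : ℂ) * framePosKernel L K (i.2.1.2 - i.2.2)) X Y‖ := by
  rw [gridCounterMatrix, Matrix.sum_apply]
  exact norm_sum_le _ _

/-- `N_g(X,Y) = 0` unless `X` is a `ψ⁺` leg. [cite: BenfattoGiulianiMastropietro2003, §1.2 The model (2.10)] -/
theorem gridCounterMatrix_apply_of_fst_charge_ne (β : ℝ) (K : TrigPolyC4v) {X : GridLeg (GridPoint L N)} (hX : X.2 ≠ 0)
    (Y : GridLeg (GridPoint L N)) : gridCounterMatrix L N β K X Y = 0 := by
  rw [gridCounterMatrix, Matrix.sum_apply]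
  refine Finset.sum_eq_zero fun i _ => Matrix.single_apply_of_ne _ _ _ _ _ ?_
  rintro ⟨h, -⟩
  exact hX (by rw [← h])

/-- `N_g(X,Y) = 0` unless `Y` is a `ψ⁻` leg. [cite: BenfattoGiulianiMastropietro2003, §1.2 The model (2.10)] -/
theorem gridCounterMatrix_apply_of_snd_charge_ne (β : ℝ) (K : TrigPolyC4v) (X : GridLeg (GridPoint L N)) {Y : GridLeg (GridPoint L N)}
    (hY : Y.2 ≠ 1) : gridCounterMatrix L N β K X Y = 0 := by
  rw [gridCounterMatrix, Matrix.sum_apply]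
  refine Finset.sum_eq_zero fun i _ => Matrix.single_apply_of_ne _ _ _ _ _ ?_
  rintro ⟨-, h⟩
  exact hY (by rw [← h])

/-- For every leg `X`, one of `N_g(X,·)`, `N_g(·,X)` vanishes identically: a matrix `S` with `‖S(X,Y)‖ ≤ ‖N_g(X,Y)‖ + ‖N_g(Y,X)‖`
(e.g. `S_g = N_g − N_gᵀ`, `−S_g`) has `‖S(X,Y)‖ ≤ ‖N_g(X,Y)‖` at `ψ⁺` legs `X` and `‖S(X,Y)‖ ≤ ‖N_g(Y,X)‖` at `ψ⁻` legs `X`.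
[cite: BenfattoGiulianiMastropietro2003, §1.2 The model (2.10)] -/
theorem norm_le_gridCounterMatrix_cases (β : ℝ) (K : TrigPolyC4v) {S : Matrix (GridLeg (GridPoint L N)) (GridLeg (GridPoint L N)) ℂ}
    (hS : ∀ X Y, ‖S X Y‖ ≤ ‖gridCounterMatrix L N β K X Y‖ + ‖gridCounterMatrix L N β K Y X‖) (X Y : GridLeg (GridPoint L N)) :
    ‖S X Y‖ ≤ (if X.2 = 0 then ‖gridCounterMatrix L N β K X Y‖ else 0) + (if X.2 = 0 then 0 else ‖gridCounterMatrix L N β K Y X‖) := by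
  refine (hS X Y).trans ?_
  by_cases h0 : X.2 = 0
  · have h1 : X.2 ≠ 1 := by rw [h0]; exact zero_ne_one
    rw [if_pos h0, if_pos h0, gridCounterMatrix_apply_of_snd_charge_ne β K Y h1, norm_zero]
  · rw [if_neg h0, if_neg h0, gridCounterMatrix_apply_of_fst_charge_ne β K h0, norm_zero]

/-- `S_g = N_g − N_gᵀ` (the matrix `S` of `GrassmannGaussianQuadraticInsertion` for `N = N_g`) satisfies `‖S_g(X,Y)‖ ≤ ‖N_g(X,Y)‖ + ‖N_g(Y,X)‖`.
[cite: BenfattoGiulianiMastropietro2006, (2.23)–(2.24)] -/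
theorem norm_gridCounterAnti_le (β : ℝ) (K : TrigPolyC4v) (X Y : GridLeg (GridPoint L N)) :
    ‖(Matrix.of fun X Y => gridCounterMatrix L N β K X Y - gridCounterMatrix L N β K Y X) X Y‖ ≤
      ‖gridCounterMatrix L N β K X Y‖ + ‖gridCounterMatrix L N β K Y X‖ := by
  rw [Matrix.of_apply]
  exact norm_sub_le _ _

/-- `−S_g` (the matrix `S` of `GrassmannGaussianQuadraticInsertion` for `N = −N_g`, i.e. for `q = −𝒩_{K,N}`) satisfies
`‖(−N_g)(X,Y) − (−N_g)(Y,X)‖ ≤ ‖N_g(X,Y)‖ + ‖N_g(Y,X)‖`. [cite: BenfattoGiulianiMastropietro2006, (2.23)–(2.24)] -/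
theorem norm_neg_gridCounterAnti_le (β : ℝ) (K : TrigPolyC4v) (X Y : GridLeg (GridPoint L N)) :
    ‖(Matrix.of fun X Y => (-gridCounterMatrix L N β K) X Y - (-gridCounterMatrix L N β K) Y X) X Y‖ ≤
      ‖gridCounterMatrix L N β K X Y‖ + ‖gridCounterMatrix L N β K Y X‖ := by
  rw [Matrix.of_apply, Matrix.neg_apply, Matrix.neg_apply]
  refine (norm_sub_le _ _).trans (le_of_eq ?_)
  rw [norm_neg, norm_neg]

/-! ### Decay-weighted row and column sums -/

section Weighted

variable (w : GridLeg (GridPoint L N) → GridLeg (GridPoint L N) → ℝ) (ω : TorusSite 2 L → ℝ)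

/-- **The `ψ⁺`-pinned weighted coefficient sum**: for every leg `X` and a spatial profile `ω ≥ 0`,
`Σ_{i : ψ⁺(i) = X} |ε_N|‖Ǩ_L(x⃗_i − y⃗_i)‖·ω(x⃗_X − y⃗_i) ≤ (|β|/N)·Σ_z ‖Ǩ_L(z)‖ ω(z)` (equality at `ψ⁺` legs; the summand depends on `i` only
through `y⃗_i`, substitute `z = x⃗_X − y⃗_i`). [cite: BenfattoGiulianiMastropietro2003, §1.2 The model (2.10)] -/
theorem sum_filter_plusLeg_norm_coeff_mul_le (hω0 : ∀ z, 0 ≤ ω z) (β : ℝ) (K : TrigPolyC4v) (X : GridLeg (GridPoint L N)) :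
    ∑ i ∈ (univ : Finset (Fin 2 × (GridPoint L N × TorusSite 2 L))).filter
        (fun i => ((((i.2.1, i.1), 0) : GridLeg (GridPoint L N))) = X),
      ‖(((β / N : ℝ)) : ℂ) * framePosKernel L K (i.2.1.2 - i.2.2)‖ * ω (X.1.1.2 - i.2.2) ≤
        |β| / N * ∑ z : TorusSite 2 L, ‖framePosKernel L K z‖ * ω z := by
  set s := (univ : Finset (Fin 2 × (GridPoint L N × TorusSite 2 L))).filter
    (fun i => ((((i.2.1, i.1), 0) : GridLeg (GridPoint L N))) = X) with hs
  have hmem : ∀ i ∈ s, i.2.1 = X.1.1 ∧ i.1 = X.1.2 := by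
    intro i hi
    rw [hs, mem_filter] at hi
    have h := hi.2
    exact ⟨by rw [← h], by rw [← h]⟩
  have hinj : Set.InjOn (fun i : Fin 2 × (GridPoint L N × TorusSite 2 L) => i.2.2) s := by
    intro i hi i' hi' h
    obtain ⟨h1, h2⟩ := hmem i hi
    obtain ⟨h1', h2'⟩ := hmem i' hi'
    exact Prod.ext (h2.trans h2'.symm) (Prod.ext (h1.trans h1'.symm) h)
  set g : TorusSite 2 L → ℝ := fun y => |β| / N * (‖framePosKernel L K (X.1.1.2 - y)‖ * ω (X.1.1.2 - y)) with hg
  have hcongr : ∀ i ∈ s, ‖(((β / N : ℝ)) : ℂ) * framePosKernel L K (i.2.1.2 - i.2.2)‖ * ω (X.1.1.2 - i.2.2) = g i.2.2 := by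
    intro i hi
    rw [hg, (hmem i hi).1, norm_mul, Complex.norm_real, Real.norm_eq_abs, abs_div, Nat.abs_cast, mul_assoc]
  have hg0 : ∀ y, 0 ≤ g y := fun y => by rw [hg]; exact mul_nonneg (by positivity) (mul_nonneg (norm_nonneg _) (hω0 _))
  calc ∑ i ∈ s, ‖(((β / N : ℝ)) : ℂ) * framePosKernel L K (i.2.1.2 - i.2.2)‖ * ω (X.1.1.2 - i.2.2)
        = ∑ i ∈ s, g i.2.2 := sum_congr rfl hcongr
    _ = ∑ y ∈ s.image (fun i : Fin 2 × (GridPoint L N × TorusSite 2 L) => i.2.2), g y := (sum_image hinj).symm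
    _ ≤ ∑ y : TorusSite 2 L, g y := sum_le_sum_of_subset_of_nonneg (subset_univ _) fun y _ _ => hg0 y
    _ = |β| / N * ∑ z : TorusSite 2 L, ‖framePosKernel L K z‖ * ω z := by
        rw [hg, ← mul_sum]
        congr 1
        exact Fintype.sum_equiv (Equiv.subLeft X.1.1.2) _ _ fun y => by simp [Equiv.subLeft]

/-- **The `ψ⁻`-pinned weighted coefficient sum**: for every leg `Y` and a spatial profile `ω ≥ 0`,
`Σ_{i : ψ⁻(i) = Y} |ε_N|‖Ǩ_L(x⃗_i − y⃗_i)‖·ω(x⃗_i − y⃗_Y) ≤ (|β|/N)·Σ_z ‖Ǩ_L(z)‖ ω(z)` (substitute `z = x⃗_i − y⃗_Y`).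
[cite: BenfattoGiulianiMastropietro2003, §1.2 The model (2.10)] -/
theorem sum_filter_minusLeg_norm_coeff_mul_le (hω0 : ∀ z, 0 ≤ ω z) (β : ℝ) (K : TrigPolyC4v) (Y : GridLeg (GridPoint L N)) :
    ∑ i ∈ (univ : Finset (Fin 2 × (GridPoint L N × TorusSite 2 L))).filter
        (fun i => (((((i.2.1.1, i.2.2), i.1), 1) : GridLeg (GridPoint L N))) = Y),
      ‖(((β / N : ℝ)) : ℂ) * framePosKernel L K (i.2.1.2 - i.2.2)‖ * ω (i.2.1.2 - Y.1.1.2) ≤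
        |β| / N * ∑ z : TorusSite 2 L, ‖framePosKernel L K z‖ * ω z := by
  set s := (univ : Finset (Fin 2 × (GridPoint L N × TorusSite 2 L))).filter
    (fun i => (((((i.2.1.1, i.2.2), i.1), 1) : GridLeg (GridPoint L N))) = Y) with hs
  have hmem : ∀ i ∈ s, i.2.1.1 = Y.1.1.1 ∧ i.2.2 = Y.1.1.2 ∧ i.1 = Y.1.2 := by
    intro i hi
    rw [hs, mem_filter] at hi
    have h := hi.2
    exact ⟨by rw [← h], by rw [← h], by rw [← h]⟩
  have hinj : Set.InjOn (fun i : Fin 2 × (GridPoint L N × TorusSite 2 L) => i.2.1.2) s := by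
    intro i hi i' hi' h
    obtain ⟨h1, h2, h3⟩ := hmem i hi
    obtain ⟨h1', h2', h3'⟩ := hmem i' hi'
    exact Prod.ext (h3.trans h3'.symm) (Prod.ext (Prod.ext (h1.trans h1'.symm) h) (h2.trans h2'.symm))
  set g : TorusSite 2 L → ℝ := fun x => |β| / N * (‖framePosKernel L K (x - Y.1.1.2)‖ * ω (x - Y.1.1.2)) with hg
  have hcongr : ∀ i ∈ s, ‖(((β / N : ℝ)) : ℂ) * framePosKernel L K (i.2.1.2 - i.2.2)‖ * ω (i.2.1.2 - Y.1.1.2) = g i.2.1.2 := by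
    intro i hi
    rw [hg, (hmem i hi).2.1, norm_mul, Complex.norm_real, Real.norm_eq_abs, abs_div, Nat.abs_cast, mul_assoc]
  have hg0 : ∀ x, 0 ≤ g x := fun x => by rw [hg]; exact mul_nonneg (by positivity) (mul_nonneg (norm_nonneg _) (hω0 _))
  calc ∑ i ∈ s, ‖(((β / N : ℝ)) : ℂ) * framePosKernel L K (i.2.1.2 - i.2.2)‖ * ω (i.2.1.2 - Y.1.1.2)
        = ∑ i ∈ s, g i.2.1.2 := sum_congr rfl hcongr
    _ = ∑ x ∈ s.image (fun i : Fin 2 × (GridPoint L N × TorusSite 2 L) => i.2.1.2), g x := (sum_image hinj).symm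
    _ ≤ ∑ x : TorusSite 2 L, g x := sum_le_sum_of_subset_of_nonneg (subset_univ _) fun x _ _ => hg0 x
    _ = |β| / N * ∑ z : TorusSite 2 L, ‖framePosKernel L K z‖ * ω z := by
        rw [hg, ← mul_sum]
        congr 1
        exact Fintype.sum_equiv (Equiv.subRight Y.1.1.2) _ _ fun x => by simp [Equiv.subRight]

variable {w ω}

/-- **Weighted row sums of `N_g`**: for a pair weight `w ≥ 0` dominated on equal-time pairs by a spatial profile `ω ≥ 0`
(`w(X,Y) ≤ ω(x⃗_X − x⃗_Y)` whenever `j_X = j_Y`), `Σ_Y ‖N_g(X,Y)‖·w(X,Y) ≤ (|β|/N)·Σ_z ‖Ǩ_L(z)‖ ω(z)` for every leg `X` (the counterterm is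
time-LOCAL: only equal-time pairs occur). [cite: BenfattoGiulianiMastropietro2003, §1.2 The model (2.10)] -/
theorem rowSum_gridCounterMatrix_le (hw0 : ∀ X Y, 0 ≤ w X Y) (hω0 : ∀ z, 0 ≤ ω z)
    (hω : ∀ X Y : GridLeg (GridPoint L N), X.1.1.1 = Y.1.1.1 → w X Y ≤ ω (X.1.1.2 - Y.1.1.2)) (β : ℝ) (K : TrigPolyC4v)
    (X : GridLeg (GridPoint L N)) :
    ∑ Y, ‖gridCounterMatrix L N β K X Y‖ * w X Y ≤ |β| / N * ∑ z : TorusSite 2 L, ‖framePosKernel L K z‖ * ω z := by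
  calc ∑ Y, ‖gridCounterMatrix L N β K X Y‖ * w X Y
        ≤ ∑ Y, (∑ i : Fin 2 × (GridPoint L N × TorusSite 2 L),
            ‖Matrix.single (((i.2.1, i.1), 0) : GridLeg (GridPoint L N)) ((((i.2.1.1, i.2.2), i.1), 1) : GridLeg (GridPoint L N))
              ((((β / N : ℝ)) : ℂ) * framePosKernel L K (i.2.1.2 - i.2.2)) X Y‖) * w X Y :=
          sum_le_sum fun Y _ => mul_le_mul_of_nonneg_right (norm_gridCounterMatrix_le β K X Y) (hw0 X Y)
    _ = ∑ i : Fin 2 × (GridPoint L N × TorusSite 2 L), ∑ Y,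
            ‖Matrix.single (((i.2.1, i.1), 0) : GridLeg (GridPoint L N)) ((((i.2.1.1, i.2.2), i.1), 1) : GridLeg (GridPoint L N))
              ((((β / N : ℝ)) : ℂ) * framePosKernel L K (i.2.1.2 - i.2.2)) X Y‖ * w X Y := by
          simp_rw [Finset.sum_mul]; rw [Finset.sum_comm]
    _ = ∑ i : Fin 2 × (GridPoint L N × TorusSite 2 L),
            if (((i.2.1, i.1), 0) : GridLeg (GridPoint L N)) = X then
              ‖(((β / N : ℝ)) : ℂ) * framePosKernel L K (i.2.1.2 - i.2.2)‖ * w X ((((i.2.1.1, i.2.2), i.1), 1)) else 0 :=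
          sum_congr rfl fun i _ => sum_norm_single_apply_mul _ _ _ X (w X)
    _ = ∑ i ∈ (univ : Finset (Fin 2 × (GridPoint L N × TorusSite 2 L))).filter
            (fun i => ((((i.2.1, i.1), 0) : GridLeg (GridPoint L N))) = X),
            ‖(((β / N : ℝ)) : ℂ) * framePosKernel L K (i.2.1.2 - i.2.2)‖ * w X ((((i.2.1.1, i.2.2), i.1), 1)) := by
          rw [Finset.sum_filter]
    _ ≤ ∑ i ∈ (univ : Finset (Fin 2 × (GridPoint L N × TorusSite 2 L))).filter
            (fun i => ((((i.2.1, i.1), 0) : GridLeg (GridPoint L N))) = X),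
            ‖(((β / N : ℝ)) : ℂ) * framePosKernel L K (i.2.1.2 - i.2.2)‖ * ω (X.1.1.2 - i.2.2) := by
          refine sum_le_sum fun i hi => mul_le_mul_of_nonneg_left ?_ (norm_nonneg _)
          have h := (mem_filter.1 hi).2
          exact hω X _ (by rw [← h])
    _ ≤ |β| / N * ∑ z : TorusSite 2 L, ‖framePosKernel L K z‖ * ω z := sum_filter_plusLeg_norm_coeff_mul_le ω hω0 β K X

/-- **Weighted column sums of `N_g`**: under the same hypotheses, `Σ_X ‖N_g(X,Y)‖·w(X,Y) ≤ (|β|/N)·Σ_z ‖Ǩ_L(z)‖ ω(z)` for every leg `Y`.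
[cite: BenfattoGiulianiMastropietro2003, §1.2 The model (2.10)] -/
theorem colSum_gridCounterMatrix_le (hw0 : ∀ X Y, 0 ≤ w X Y) (hω0 : ∀ z, 0 ≤ ω z)
    (hω : ∀ X Y : GridLeg (GridPoint L N), X.1.1.1 = Y.1.1.1 → w X Y ≤ ω (X.1.1.2 - Y.1.1.2)) (β : ℝ) (K : TrigPolyC4v)
    (Y : GridLeg (GridPoint L N)) :
    ∑ X, ‖gridCounterMatrix L N β K X Y‖ * w X Y ≤ |β| / N * ∑ z : TorusSite 2 L, ‖framePosKernel L K z‖ * ω z := by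
  calc ∑ X, ‖gridCounterMatrix L N β K X Y‖ * w X Y
        ≤ ∑ X, (∑ i : Fin 2 × (GridPoint L N × TorusSite 2 L),
            ‖Matrix.single (((i.2.1, i.1), 0) : GridLeg (GridPoint L N)) ((((i.2.1.1, i.2.2), i.1), 1) : GridLeg (GridPoint L N))
              ((((β / N : ℝ)) : ℂ) * framePosKernel L K (i.2.1.2 - i.2.2)) X Y‖) * w X Y :=
          sum_le_sum fun X _ => mul_le_mul_of_nonneg_right (norm_gridCounterMatrix_le β K X Y) (hw0 X Y)
    _ = ∑ i : Fin 2 × (GridPoint L N × TorusSite 2 L), ∑ X,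
            ‖Matrix.single (((i.2.1, i.1), 0) : GridLeg (GridPoint L N)) ((((i.2.1.1, i.2.2), i.1), 1) : GridLeg (GridPoint L N))
              ((((β / N : ℝ)) : ℂ) * framePosKernel L K (i.2.1.2 - i.2.2)) X Y‖ * w X Y := by
          simp_rw [Finset.sum_mul]; rw [Finset.sum_comm]
    _ = ∑ i : Fin 2 × (GridPoint L N × TorusSite 2 L),
            if ((((i.2.1.1, i.2.2), i.1), 1) : GridLeg (GridPoint L N)) = Y then
              ‖(((β / N : ℝ)) : ℂ) * framePosKernel L K (i.2.1.2 - i.2.2)‖ * w (((i.2.1, i.1), 0)) Y else 0 :=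
          sum_congr rfl fun i _ => sum_norm_single_apply_mul' _ _ _ Y (fun X => w X Y)
    _ = ∑ i ∈ (univ : Finset (Fin 2 × (GridPoint L N × TorusSite 2 L))).filter
            (fun i => (((((i.2.1.1, i.2.2), i.1), 1) : GridLeg (GridPoint L N))) = Y),
            ‖(((β / N : ℝ)) : ℂ) * framePosKernel L K (i.2.1.2 - i.2.2)‖ * w (((i.2.1, i.1), 0)) Y := by
          rw [Finset.sum_filter]
    _ ≤ ∑ i ∈ (univ : Finset (Fin 2 × (GridPoint L N × TorusSite 2 L))).filter
            (fun i => (((((i.2.1.1, i.2.2), i.1), 1) : GridLeg (GridPoint L N))) = Y),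
            ‖(((β / N : ℝ)) : ℂ) * framePosKernel L K (i.2.1.2 - i.2.2)‖ * ω (i.2.1.2 - Y.1.1.2) := by
          refine sum_le_sum fun i hi => mul_le_mul_of_nonneg_left ?_ (norm_nonneg _)
          have h := (mem_filter.1 hi).2
          exact hω _ Y (by rw [← h])
    _ ≤ |β| / N * ∑ z : TorusSite 2 L, ‖framePosKernel L K z‖ * ω z := sum_filter_minusLeg_norm_coeff_mul_le ω hω0 β K Y

/-- **Weighted row sums of `N_gᵀ`** (even profile `ω(−z) = ω(z)`): `Σ_Y ‖N_g(Y,X)‖·w(X,Y) ≤ (|β|/N)·Σ_z ‖Ǩ_L(z)‖ ω(z)`.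
[cite: BenfattoGiulianiMastropietro2003, §1.2 The model (2.10)] -/
theorem rowSum_gridCounterMatrix_transpose_le (hw0 : ∀ X Y, 0 ≤ w X Y) (hω0 : ∀ z, 0 ≤ ω z) (hωe : ∀ z, ω (-z) = ω z)
    (hω : ∀ X Y : GridLeg (GridPoint L N), X.1.1.1 = Y.1.1.1 → w X Y ≤ ω (X.1.1.2 - Y.1.1.2)) (β : ℝ) (K : TrigPolyC4v)
    (X : GridLeg (GridPoint L N)) :
    ∑ Y, ‖gridCounterMatrix L N β K Y X‖ * w X Y ≤ |β| / N * ∑ z : TorusSite 2 L, ‖framePosKernel L K z‖ * ω z := by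
  -- the transposed weight `w'(Y,X) := w(X,Y)` is dominated by the same (even) profile
  have hω' : ∀ Y X : GridLeg (GridPoint L N), Y.1.1.1 = X.1.1.1 → w X Y ≤ ω (Y.1.1.2 - X.1.1.2) := by
    intro Y X h
    rw [← hωe, neg_sub]
    exact hω X Y h.symm
  exact colSum_gridCounterMatrix_le (w := fun Y X => w X Y) (fun Y X => hw0 X Y) hω0 hω' β K X

/-- **Weighted column sums of `N_gᵀ`** (even profile): `Σ_X ‖N_g(Y,X)‖·w(X,Y) ≤ (|β|/N)·Σ_z ‖Ǩ_L(z)‖ ω(z)`.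
[cite: BenfattoGiulianiMastropietro2003, §1.2 The model (2.10)] -/
theorem colSum_gridCounterMatrix_transpose_le (hw0 : ∀ X Y, 0 ≤ w X Y) (hω0 : ∀ z, 0 ≤ ω z) (hωe : ∀ z, ω (-z) = ω z)
    (hω : ∀ X Y : GridLeg (GridPoint L N), X.1.1.1 = Y.1.1.1 → w X Y ≤ ω (X.1.1.2 - Y.1.1.2)) (β : ℝ) (K : TrigPolyC4v)
    (Y : GridLeg (GridPoint L N)) :
    ∑ X, ‖gridCounterMatrix L N β K Y X‖ * w X Y ≤ |β| / N * ∑ z : TorusSite 2 L, ‖framePosKernel L K z‖ * ω z := by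
  have hω' : ∀ Y X : GridLeg (GridPoint L N), Y.1.1.1 = X.1.1.1 → w X Y ≤ ω (Y.1.1.2 - X.1.1.2) := by
    intro Y X h
    rw [← hωe, neg_sub]
    exact hω X Y h.symm
  exact rowSum_gridCounterMatrix_le (w := fun Y X => w X Y) (fun Y X => hw0 X Y) hω0 hω' β K Y

/-- **Weighted row sums of `S_g = N_g − N_gᵀ` and of `−S_g`** (any `S` with `‖S(X,Y)‖ ≤ ‖N_g(X,Y)‖ + ‖N_g(Y,X)‖`; even profile):
`Σ_Y ‖S(X,Y)‖·w(X,Y) ≤ (|β|/N)·Σ_z ‖Ǩ_L(z)‖ ω(z)` — NOT twice that: at a `ψ⁺` leg only `N_g(X,·)` is present, at a `ψ⁻` leg only `N_g(·,X)`.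
This is the `ν_w` of the resolvent step `(1 + G S_g)⁻¹ G` (`WeightedRowSumResolvent.rowSum_resolvent_mul_le`).
[cite: BenfattoGiulianiMastropietro2006, (2.23)–(2.24)] -/
theorem rowSum_le_of_norm_le_gridCounterMatrix (hw0 : ∀ X Y, 0 ≤ w X Y) (hω0 : ∀ z, 0 ≤ ω z) (hωe : ∀ z, ω (-z) = ω z)
    (hω : ∀ X Y : GridLeg (GridPoint L N), X.1.1.1 = Y.1.1.1 → w X Y ≤ ω (X.1.1.2 - Y.1.1.2)) (β : ℝ) (K : TrigPolyC4v)
    {S : Matrix (GridLeg (GridPoint L N)) (GridLeg (GridPoint L N)) ℂ}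
    (hS : ∀ X Y, ‖S X Y‖ ≤ ‖gridCounterMatrix L N β K X Y‖ + ‖gridCounterMatrix L N β K Y X‖) (X : GridLeg (GridPoint L N)) :
    ∑ Y, ‖S X Y‖ * w X Y ≤ |β| / N * ∑ z : TorusSite 2 L, ‖framePosKernel L K z‖ * ω z := by
  by_cases h0 : X.2 = 0
  · calc ∑ Y, ‖S X Y‖ * w X Y ≤ ∑ Y, ‖gridCounterMatrix L N β K X Y‖ * w X Y := by
          refine sum_le_sum fun Y _ => mul_le_mul_of_nonneg_right ?_ (hw0 X Y)
          have h := norm_le_gridCounterMatrix_cases β K hS X Y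
          rwa [if_pos h0, if_pos h0, add_zero] at h
      _ ≤ _ := rowSum_gridCounterMatrix_le hw0 hω0 hω β K X
  · calc ∑ Y, ‖S X Y‖ * w X Y ≤ ∑ Y, ‖gridCounterMatrix L N β K Y X‖ * w X Y := by
          refine sum_le_sum fun Y _ => mul_le_mul_of_nonneg_right ?_ (hw0 X Y)
          have h := norm_le_gridCounterMatrix_cases β K hS X Y
          rwa [if_neg h0, if_neg h0, zero_add] at h
      _ ≤ _ := rowSum_gridCounterMatrix_transpose_le hw0 hω0 hωe hω β K X

/-- **Weighted column sums of `S_g = N_g − N_gᵀ` and of `−S_g`** (any `S` with `‖S(X,Y)‖ ≤ ‖N_g(X,Y)‖ + ‖N_g(Y,X)‖`; even profile):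
`Σ_X ‖S(X,Y)‖·w(X,Y) ≤ (|β|/N)·Σ_z ‖Ǩ_L(z)‖ ω(z)`. [cite: BenfattoGiulianiMastropietro2006, (2.23)–(2.24)] -/
theorem colSum_le_of_norm_le_gridCounterMatrix (hw0 : ∀ X Y, 0 ≤ w X Y) (hω0 : ∀ z, 0 ≤ ω z) (hωe : ∀ z, ω (-z) = ω z)
    (hω : ∀ X Y : GridLeg (GridPoint L N), X.1.1.1 = Y.1.1.1 → w X Y ≤ ω (X.1.1.2 - Y.1.1.2)) (β : ℝ) (K : TrigPolyC4v)
    {S : Matrix (GridLeg (GridPoint L N)) (GridLeg (GridPoint L N)) ℂ}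
    (hS : ∀ X Y, ‖S X Y‖ ≤ ‖gridCounterMatrix L N β K X Y‖ + ‖gridCounterMatrix L N β K Y X‖) (Y : GridLeg (GridPoint L N)) :
    ∑ X, ‖S X Y‖ * w X Y ≤ |β| / N * ∑ z : TorusSite 2 L, ‖framePosKernel L K z‖ * ω z := by
  -- column `Y` of `S`: at a `ψ⁻` leg `Y` only `N_g(·,Y)` and at a `ψ⁺` leg only `N_g(Y,·)` can be nonzero
  by_cases h1 : Y.2 = 1
  · have hY0 : Y.2 ≠ 0 := by rw [h1]; exact one_ne_zero
    calc ∑ X, ‖S X Y‖ * w X Y ≤ ∑ X, ‖gridCounterMatrix L N β K X Y‖ * w X Y := by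
          refine sum_le_sum fun X _ => mul_le_mul_of_nonneg_right ((hS X Y).trans ?_) (hw0 X Y)
          rw [gridCounterMatrix_apply_of_fst_charge_ne β K hY0, norm_zero, add_zero]
      _ ≤ _ := colSum_gridCounterMatrix_le hw0 hω0 hω β K Y
  · calc ∑ X, ‖S X Y‖ * w X Y ≤ ∑ X, ‖gridCounterMatrix L N β K Y X‖ * w X Y := by
          refine sum_le_sum fun X _ => mul_le_mul_of_nonneg_right ((hS X Y).trans ?_) (hw0 X Y)
          rw [gridCounterMatrix_apply_of_snd_charge_ne β K X h1, norm_zero, zero_add]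
      _ ≤ _ := colSum_gridCounterMatrix_transpose_le hw0 hω0 hωe hω β K Y

end Weighted

/-! ### Unweighted forms -/

/-- **Unweighted row sums of `S_g`** (any `S` with `‖S(X,Y)‖ ≤ ‖N_g(X,Y)‖ + ‖N_g(Y,X)‖`): `Σ_Y ‖S(X,Y)‖ ≤ (|β|/N)·Σ_z ‖Ǩ_L(z)‖` — the intrinsic
`ℓ¹` size of the frame's position kernel (`HubbardGridCounterQuadraticL1`). [cite: BenfattoGiulianiMastropietro2003, §1.2 The model (2.10)] -/
theorem rowSum_le_of_norm_le_gridCounterMatrix_unweighted (β : ℝ) (K : TrigPolyC4v)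
    {S : Matrix (GridLeg (GridPoint L N)) (GridLeg (GridPoint L N)) ℂ}
    (hS : ∀ X Y, ‖S X Y‖ ≤ ‖gridCounterMatrix L N β K X Y‖ + ‖gridCounterMatrix L N β K Y X‖) (X : GridLeg (GridPoint L N)) :
    ∑ Y, ‖S X Y‖ ≤ |β| / N * ∑ z : TorusSite 2 L, ‖framePosKernel L K z‖ := by
  have h := rowSum_le_of_norm_le_gridCounterMatrix (w := fun _ _ => (1 : ℝ)) (ω := fun _ => (1 : ℝ)) (fun _ _ => zero_le_one)
    (fun _ => zero_le_one) (fun _ => rfl) (fun _ _ _ => le_rfl) β K hS X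
  simpa only [mul_one] using h

/-- **Unweighted column sums of `S_g`** (any `S` with `‖S(X,Y)‖ ≤ ‖N_g(X,Y)‖ + ‖N_g(Y,X)‖`): `Σ_X ‖S(X,Y)‖ ≤ (|β|/N)·Σ_z ‖Ǩ_L(z)‖`.
[cite: BenfattoGiulianiMastropietro2003, §1.2 The model (2.10)] -/
theorem colSum_le_of_norm_le_gridCounterMatrix_unweighted (β : ℝ) (K : TrigPolyC4v)
    {S : Matrix (GridLeg (GridPoint L N)) (GridLeg (GridPoint L N)) ℂ}
    (hS : ∀ X Y, ‖S X Y‖ ≤ ‖gridCounterMatrix L N β K X Y‖ + ‖gridCounterMatrix L N β K Y X‖) (Y : GridLeg (GridPoint L N)) :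
    ∑ X, ‖S X Y‖ ≤ |β| / N * ∑ z : TorusSite 2 L, ‖framePosKernel L K z‖ := by
  have h := colSum_le_of_norm_le_gridCounterMatrix (w := fun _ _ => (1 : ℝ)) (ω := fun _ => (1 : ℝ)) (fun _ _ => zero_le_one)
    (fun _ => zero_le_one) (fun _ => rfl) (fun _ _ _ => le_rfl) β K hS Y
  simpa only [mul_one] using h

end Literature.MathematicalPhysics.QuantumLattice

end
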